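import Summits.Parity.GeneralizedHardyLittlewood.Theorems.DilatedTableChowla.Negative.DilatedTableChowlaScale

/-!
# `DilatedTableChowla` (stmt-Parity-14271): every stated hypothesis is load-bearing; the `q = 1` slice and every fixed modulus

Negative lemmas for the crux `LiouvilleShiftedTables.DilatedTableChowla` (route LiouvilleShiftedTables, X1; cdisprove seat), landed verbatim from the crux work file `Cruxes/DilatedTableChowla/Disproof.lean` (§4–§5 there) so that skeletons, ideators and provers can import them.  Notation (`rows`, `cols`, `S`, `F`, `lhs`, `crux_iff_lhs`) from `DilatedTableChowlaBlocks`. [folklore]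
-/

namespace Summit.Parity.GeneralizedHardyLittlewood.Theorems.DilatedTableChowla.Negative

open Summit.Parity.GeneralizedHardyLittlewood.Theses.LiouvilleShiftedTables
open Finset

/-! ## §4 (a) LOAD-BEARING hypotheses: the crux with one hypothesis dropped is FALSE

Every stated hypothesis except `0 < C` is used by any proof. -/

/-- The crux with the hypothesis `c ≠ 0` dropped. -/
def WithoutShiftNeZero : Prop :=
  ∀ c : ℤ, ∀ δ : ℝ, 0 < δ → δ ≤ 1 / 12 → ∀ C : ℝ, 0 < C → ∃ x₀ : ℝ, ∀ x : ℝ, x₀ ≤ x →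
    ∀ A : ℝ, x ^ δ ≤ A → A ≤ x ^ (1 / 3 + δ) → ∀ u v : ℕ → ℕ,
      lhs c δ x A u v ≤ x ^ 2 / Real.log x ^ C

/-- The crux with `0 < δ` dropped. -/
def WithoutDeltaPos : Prop :=
  ∀ c : ℤ, c ≠ 0 → ∀ δ : ℝ, δ ≤ 1 / 12 → ∀ C : ℝ, 0 < C → ∃ x₀ : ℝ, ∀ x : ℝ, x₀ ≤ x →
    ∀ A : ℝ, x ^ δ ≤ A → A ≤ x ^ (1 / 3 + δ) → ∀ u v : ℕ → ℕ,
      lhs c δ x A u v ≤ x ^ 2 / Real.log x ^ C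

/-- The crux with `δ ≤ 1/12` dropped. -/
def WithoutDeltaLe : Prop :=
  ∀ c : ℤ, c ≠ 0 → ∀ δ : ℝ, 0 < δ → ∀ C : ℝ, 0 < C → ∃ x₀ : ℝ, ∀ x : ℝ, x₀ ≤ x →
    ∀ A : ℝ, x ^ δ ≤ A → A ≤ x ^ (1 / 3 + δ) → ∀ u v : ℕ → ℕ,
      lhs c δ x A u v ≤ x ^ 2 / Real.log x ^ C

/-- The crux with the lower window `x^δ ≤ A` dropped. -/
def WithoutLowerWindow : Prop :=
  ∀ c : ℤ, c ≠ 0 → ∀ δ : ℝ, 0 < δ → δ ≤ 1 / 12 → ∀ C : ℝ, 0 < C → ∃ x₀ : ℝ, ∀ x : ℝ, x₀ ≤ x →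
    ∀ A : ℝ, A ≤ x ^ (1 / 3 + δ) → ∀ u v : ℕ → ℕ,
      lhs c δ x A u v ≤ x ^ 2 / Real.log x ^ C

/-- The crux with the upper window `A ≤ x^{1/3+δ}` dropped. -/
def WithoutUpperWindow : Prop :=
  ∀ c : ℤ, c ≠ 0 → ∀ δ : ℝ, 0 < δ → δ ≤ 1 / 12 → ∀ C : ℝ, 0 < C → ∃ x₀ : ℝ, ∀ x : ℝ, x₀ ≤ x →
    ∀ A : ℝ, x ^ δ ≤ A → ∀ u v : ℕ → ℕ,
      lhs c δ x A u v ≤ x ^ 2 / Real.log x ^ C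

/-- The crux with `0 < C` dropped (all real `C`). -/
def WithoutCPos : Prop :=
  ∀ c : ℤ, c ≠ 0 → ∀ δ : ℝ, 0 < δ → δ ≤ 1 / 12 → ∀ C : ℝ, ∃ x₀ : ℝ, ∀ x : ℝ, x₀ ≤ x →
    ∀ A : ℝ, x ^ δ ≤ A → A ≤ x ^ (1 / 3 + δ) → ∀ u v : ℕ → ℕ,
      lhs c δ x A u v ≤ x ^ 2 / Real.log x ^ C

/-- (a1) `c ≠ 0` is load-bearing: at `c = 0`, `λ(ab)λ(a'b) = λ(a)λ(a')` and the `q = 1` table alone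
has fourth moment `#rows² #cols² = x²` exactly (witness `δ = 1/12`, `C = 1`, `x = N²⁴`, `A = N²`). -/
theorem false_without_shift_ne_zero : ¬ WithoutShiftNeZero := by
  intro h
  obtain ⟨x₀, hx₀⟩ := h 0 (1 / 12) (by norm_num) le_rfl 1 one_pos
  obtain ⟨N, hN2, -, hxN⟩ := exists_scale x₀ 2 (by norm_num)
  have hN1 : 1 ≤ N := by omega
  have hN0 : N ≠ 0 := by omega
  set x : ℝ := ((N : ℝ)) ^ 24 with hx
  have hA1 : x ^ (1 / 12 : ℝ) ≤ (N : ℝ) ^ 2 := (pow24_rpow_eq_pow N (by norm_num)).le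
  have hA2 : ((N : ℝ)) ^ 2 ≤ x ^ (1 / 3 + 1 / 12 : ℝ) := by
    rw [hx, pow24_rpow_eq_pow N (k := 10) (by norm_num)]
    exact pow_le_pow_right₀ (by exact_mod_cast hN1) (by norm_num)
  have key := hx₀ x hxN ((N : ℝ) ^ 2) hA1 hA2 (fun _ => 0) (fun _ => 0)
  have hF : F 0 x ((N : ℝ) ^ 2) 1 0 0 = ((N : ℝ)) ^ 48 := by
    rw [F_zero_shift, rows_one, cols_one, floor_natCast_pow, floor_two_mul_natCast_pow,
      Nat.card_Ioc, hx, pow24_div_pow N hN0 (by norm_num), floor_natCast_pow, Nat.card_Icc]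
    rw [show 2 * N ^ 2 - N ^ 2 = N ^ 2 by omega, show N ^ (24 - 2) + 1 - 1 = N ^ 22 by norm_num]
    push_cast; ring
  have hlow : ((N : ℝ)) ^ 48 ≤ lhs 0 (1 / 12) x ((N : ℝ) ^ 2) (fun _ => 0) (fun _ => 0) := by
    rw [← hF]
    exact F_one_le_lhs 0 (by norm_num) (one_le_pow24 hN1) _ (fun _ => 0) (fun _ => 0)
  have hrhs := rhs_pow24_lt hN2
  have hpos : (0 : ℝ) ≤ (N : ℝ) ^ 48 := by positivity
  linarith

/-- (a2) `0 < δ` is load-bearing: at `δ = 0` the window admits `A = 1`, a one-row table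
(`a = 2`), whose fourth moment is `#cols² = x²` (witness `c = 1`, `C = 1`, `x = N²⁴`). -/
theorem false_without_delta_pos : ¬ WithoutDeltaPos := by
  intro h
  obtain ⟨x₀, hx₀⟩ := h 1 one_ne_zero 0 (by norm_num) 1 one_pos
  obtain ⟨N, hN2, -, hxN⟩ := exists_scale x₀ 2 (by norm_num)
  have hN1 : 1 ≤ N := by omega
  set x : ℝ := ((N : ℝ)) ^ 24 with hx
  have hx1 : 1 ≤ x := one_le_pow24 hN1
  have hA1 : x ^ (0 : ℝ) ≤ (1 : ℝ) := by rw [Real.rpow_zero]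
  have hA2 : (1 : ℝ) ≤ x ^ (1 / 3 + 0 : ℝ) := Real.one_le_rpow hx1 (by norm_num)
  have key := hx₀ x hxN 1 hA1 hA2 (fun _ => 2) (fun _ => 0)
  have hrows : rows 1 1 2 = {2} := by
    rw [rows_one]; norm_num
  have hcols : (cols x 1 1 0).card = N ^ 24 := by
    rw [cols_one, div_one, hx, floor_natCast_pow, Nat.card_Icc]; omega
  have hlow : ((N : ℝ)) ^ 48 ≤ lhs 1 0 x 1 (fun _ => 2) (fun _ => 0) := by
    have h1 := rows_mul_cols_sq_le_F (c := 1) (by norm_num) x 1 1 2 0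
    rw [hrows, hcols, Finset.card_singleton] at h1
    push_cast at h1
    rw [one_mul, ← pow_mul] at h1
    have h2 : F 1 x 1 1 2 0 ≤ lhs 1 0 x 1 (fun _ => 2) (fun _ => 0) :=
      F_one_le_lhs 1 (le_refl (0:ℝ)) hx1 1 (fun _ => 2) (fun _ => 0)
    exact h1.trans h2
  have hrhs := rhs_pow24_lt hN2
  have hpos : (0 : ℝ) ≤ (N : ℝ) ^ 48 := by positivity
  linarith

/-- With one column (`⌊x/A⌋ = 1`) every `S(a,a')² = 1` for `c ≥ 0`: no cancellation at all. -/
theorem F_one_col {c : ℤ} (hc : 0 ≤ c) {x A : ℝ} (hxA : ⌊x / A⌋₊ = 1) (u : ℕ) :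
    F c x A 1 u 0 = (((rows A 1 u).card : ℝ)) ^ 2 := by
  unfold F
  have hcols : cols x A 1 0 = {1} := by rw [cols_one, hxA]; rfl
  have : ∀ a ∈ rows A 1 u, ∀ a' ∈ rows A 1 u, (S c x A 1 0 a a') ^ 2 = 1 := by
    intro a ha a' ha'
    have h1 : (1 : ℤ) ≤ a := by exact_mod_cast one_le_of_mem_rows ha
    have h2 : (1 : ℤ) ≤ a' := by exact_mod_cast one_le_of_mem_rows ha'
    unfold S
    rw [hcols, Finset.sum_singleton, mul_pow, L_sq_of_pos (by push_cast; linarith),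
      L_sq_of_pos (by push_cast; linarith), mul_one]
  rw [Finset.sum_congr rfl fun a ha => Finset.sum_congr rfl fun a' ha' => this a ha a' ha']
  simp; ring

/-- (a3) `δ ≤ 1/12` (some upper bound on `δ`) is load-bearing: at `δ = 1`, `A = x` is admissible,
the table has one column and `F = #rows² = x²` (the negatives-index pattern of stmt-Parity-4218). -/
theorem false_without_delta_le : ¬ WithoutDeltaLe := by
  intro h
  obtain ⟨x₀, hx₀⟩ := h 1 one_ne_zero 1 one_pos 1 one_pos
  obtain ⟨N, hN2, -, hxN⟩ := exists_scale x₀ 2 (by norm_num)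
  have hN1 : 1 ≤ N := by omega
  have hN0 : N ≠ 0 := by omega
  set x : ℝ := ((N : ℝ)) ^ 24 with hx
  have hx1 : 1 ≤ x := one_le_pow24 hN1
  have hxpos : 0 < x := by linarith
  have hA1 : x ^ (1 : ℝ) ≤ x := by rw [Real.rpow_one]
  have hA2 : x ≤ x ^ (1 / 3 + 1 : ℝ) := by
    calc x = x ^ (1 : ℝ) := (Real.rpow_one x).symm
      _ ≤ x ^ (1 / 3 + 1 : ℝ) := Real.rpow_le_rpow_of_exponent_le hx1 (by norm_num)
  have key := hx₀ x hxN x hA1 hA2 (fun _ => 0) (fun _ => 0)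
  have hxA : ⌊x / x⌋₊ = 1 := by rw [div_self hxpos.ne', Nat.floor_one]
  have hF : F 1 x x 1 0 0 = ((N : ℝ)) ^ 48 := by
    rw [F_one_col (by norm_num) hxA, rows_one, hx, floor_natCast_pow, floor_two_mul_natCast_pow,
      Nat.card_Ioc, show 2 * N ^ 24 - N ^ 24 = N ^ 24 by omega]
    push_cast; ring
  have hlow : ((N : ℝ)) ^ 48 ≤ lhs 1 1 x x (fun _ => 0) (fun _ => 0) := by
    rw [← hF]; exact F_one_le_lhs 1 (by norm_num) hx1 x (fun _ => 0) (fun _ => 0)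
  have hrhs := rhs_pow24_lt hN2
  have hpos : (0 : ℝ) ≤ (N : ℝ) ^ 48 := by positivity
  linarith

/-- (a4) the lower window `x^δ ≤ A` is load-bearing: `A = 1` gives the one-row table `a = 2`
with `x` columns and `F ≥ x²` (witness `c = 1`, `δ = 1/12`, `C = 1`, `x = N²⁴`). -/
theorem false_without_lower_window : ¬ WithoutLowerWindow := by
  intro h
  obtain ⟨x₀, hx₀⟩ := h 1 one_ne_zero (1 / 12) (by norm_num) le_rfl 1 one_pos
  obtain ⟨N, hN2, -, hxN⟩ := exists_scale x₀ 2 (by norm_num)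
  have hN1 : 1 ≤ N := by omega
  set x : ℝ := ((N : ℝ)) ^ 24 with hx
  have hx1 : 1 ≤ x := one_le_pow24 hN1
  have hA2 : (1 : ℝ) ≤ x ^ (1 / 3 + 1 / 12 : ℝ) := Real.one_le_rpow hx1 (by norm_num)
  have key := hx₀ x hxN 1 hA2 (fun _ => 2) (fun _ => 0)
  have hrows : rows 1 1 2 = {2} := by
    rw [rows_one]; norm_num
  have hcols : (cols x 1 1 0).card = N ^ 24 := by
    rw [cols_one, div_one, hx, floor_natCast_pow, Nat.card_Icc]; omega
  have hlow : ((N : ℝ)) ^ 48 ≤ lhs 1 (1 / 12) x 1 (fun _ => 2) (fun _ => 0) := by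
    have h1 := rows_mul_cols_sq_le_F (c := 1) (by norm_num) x 1 1 2 0
    rw [hrows, hcols, Finset.card_singleton] at h1
    push_cast at h1
    rw [one_mul, ← pow_mul] at h1
    have h2 : F 1 x 1 1 2 0 ≤ lhs 1 (1 / 12) x 1 (fun _ => 2) (fun _ => 0) :=
      F_one_le_lhs 1 (by norm_num : (0:ℝ) ≤ 1 / 12) hx1 1 (fun _ => 2) (fun _ => 0)
    exact h1.trans h2
  have hrhs := rhs_pow24_lt hN2
  have hpos : (0 : ℝ) ≤ (N : ℝ) ^ 48 := by positivity
  linarith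

/-- (a5) the upper window `A ≤ x^{1/3+δ}` is load-bearing: `A = x` gives one column, `F = x²`
(witness `c = 1`, `δ = 1/12`, `C = 1`, `x = N²⁴`). -/
theorem false_without_upper_window : ¬ WithoutUpperWindow := by
  intro h
  obtain ⟨x₀, hx₀⟩ := h 1 one_ne_zero (1 / 12) (by norm_num) le_rfl 1 one_pos
  obtain ⟨N, hN2, -, hxN⟩ := exists_scale x₀ 2 (by norm_num)
  have hN1 : 1 ≤ N := by omega
  set x : ℝ := ((N : ℝ)) ^ 24 with hx
  have hx1 : 1 ≤ x := one_le_pow24 hN1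
  have hxpos : 0 < x := by linarith
  have hA1 : x ^ (1 / 12 : ℝ) ≤ x := by
    calc x ^ (1 / 12 : ℝ) ≤ x ^ (1 : ℝ) := Real.rpow_le_rpow_of_exponent_le hx1 (by norm_num)
      _ = x := Real.rpow_one x
  have key := hx₀ x hxN x hA1 (fun _ => 0) (fun _ => 0)
  have hxA : ⌊x / x⌋₊ = 1 := by rw [div_self hxpos.ne', Nat.floor_one]
  have hF : F 1 x x 1 0 0 = ((N : ℝ)) ^ 48 := by
    rw [F_one_col (by norm_num) hxA, rows_one, hx, floor_natCast_pow, floor_two_mul_natCast_pow,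
      Nat.card_Ioc, show 2 * N ^ 24 - N ^ 24 = N ^ 24 by omega]
    push_cast; ring
  have hlow : ((N : ℝ)) ^ 48 ≤ lhs 1 (1 / 12) x x (fun _ => 0) (fun _ => 0) := by
    rw [← hF]; exact F_one_le_lhs 1 (by norm_num) hx1 x (fun _ => 0) (fun _ => 0)
  have hrhs := rhs_pow24_lt hN2
  have hpos : (0 : ℝ) ≤ (N : ℝ) ^ 48 := by positivity
  linarith

/-- (a6) `0 < C` is NOT load-bearing: the crux implies its `C`-unrestricted form
(the claim is monotone in `C` once `log x ≥ 1`). -/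
theorem withoutCPos_of_crux (h : DilatedTableChowla) : WithoutCPos := by
  rw [crux_iff_lhs] at h
  intro c hc δ hδ hδ' C
  rcases lt_or_ge 0 C with hC | hC
  · exact h c hc δ hδ hδ' C hC
  · obtain ⟨x₀, hx₀⟩ := h c hc δ hδ hδ' 1 one_pos
    refine ⟨max x₀ 3, fun x hx A hA1 hA2 u v => ?_⟩
    have hx0 : x₀ ≤ x := le_trans (le_max_left _ _) hx
    have hx3 : (3 : ℝ) ≤ x := le_trans (le_max_right _ _) hx
    have key := hx₀ x hx0 A hA1 hA2 u v
    have hlog : 1 ≤ Real.log x := by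
      rw [Real.le_log_iff_exp_le (by linarith)]
      have := Real.exp_one_lt_d9
      linarith
    refine key.trans (div_le_div_of_nonneg_left (by positivity) (Real.rpow_pos_of_pos (by linarith) C) ?_)
    calc Real.log x ^ C ≤ Real.log x ^ (1 : ℝ) := Real.rpow_le_rpow_of_exponent_le hlog (by linarith)
      _ = Real.log x ^ (1 : ℝ) := rfl


/-! ## What the crux contains: the `q = 1` slice (`TableChowla`) and every FIXED modulus -/

/-- (i) The `[deps: TableChowla]` edge: the crux implies its `q = 1` slice `TableChowla`
(stmt-Parity-14270) — drop the dilations `q ≥ 2`. -/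
theorem crux_imp_tableChowla (h : DilatedTableChowla) : TableChowla := by
  rw [crux_iff_lhs] at h
  intro c hc δ hδ hδ' C hC
  obtain ⟨x₀, hx₀⟩ := h c hc δ hδ hδ' C hC
  refine ⟨max x₀ 1, fun x hx A hA1 hA2 => ?_⟩
  have hx0 : x₀ ≤ x := le_trans (le_max_left _ _) hx
  have hx1 : (1 : ℝ) ≤ x := le_trans (le_max_right _ _) hx
  have key := hx₀ x hx0 A hA1 hA2 (fun _ => 0) (fun _ => 0)
  have h1 := F_one_le_lhs c hδ.le hx1 A (fun _ => 0) (fun _ => 0)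
  rw [F_one_eq_table] at h1
  exact h1.trans key

/-- (k) NECESSITY OF BEATING EVERY CLASS AT EVERY FIXED MODULUS. For each fixed `q₀ ≥ 1` the crux
forces `q₀³ F(q₀,u,v) ≤ x²/(log x)^C` for ALL classes `(u,v)` and all large `x`: the `ℓ¹`-average
over dilations gives no protection to any single small modulus (only to sparse sets of large ones,
see §10). In particular a Siegel-type obstruction at ONE bounded conductor would refute the crux. -/
theorem crux_imp_fixedModulus (h : DilatedTableChowla) {q₀ : ℕ} (hq₀ : 1 ≤ q₀) :
    ∀ c : ℤ, c ≠ 0 → ∀ δ : ℝ, 0 < δ → δ ≤ 1 / 12 → ∀ C : ℝ, 0 < C → ∃ x₀ : ℝ, ∀ x : ℝ, x₀ ≤ x →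
      ∀ A : ℝ, x ^ δ ≤ A → A ≤ x ^ (1 / 3 + δ) → ∀ u₀ v₀ : ℕ,
        (q₀ : ℝ) ^ 3 * F c x A q₀ u₀ v₀ ≤ x ^ 2 / Real.log x ^ C := by
  rw [crux_iff_lhs] at h
  intro c hc δ hδ hδ' C hC
  obtain ⟨x₀, hx₀⟩ := h c hc δ hδ hδ' C hC
  refine ⟨max x₀ ((q₀ : ℝ) ^ (2 / δ)), fun x hx A hA1 hA2 u₀ v₀ => ?_⟩
  have hx0 : x₀ ≤ x := le_trans (le_max_left _ _) hx
  have hxq : (q₀ : ℝ) ^ (2 / δ) ≤ x := le_trans (le_max_right _ _) hx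
  have hq0' : (0 : ℝ) ≤ q₀ := Nat.cast_nonneg q₀
  have hq : q₀ ≤ ⌊x ^ (δ / 2)⌋₊ := by
    apply Nat.le_floor
    have h1 : ((q₀ : ℝ) ^ (2 / δ)) ^ (δ / 2) ≤ x ^ (δ / 2) :=
      Real.rpow_le_rpow (by positivity) hxq (by linarith)
    rwa [← Real.rpow_mul hq0', show 2 / δ * (δ / 2) = 1 by field_simp, Real.rpow_one] at h1
  have key := hx₀ x hx0 A hA1 hA2 (fun _ => u₀) (fun _ => v₀)
  exact (term_le_lhs c δ x A (fun _ => u₀) (fun _ => v₀) hq₀ hq).trans key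

end Summit.Parity.GeneralizedHardyLittlewood.Theorems.DilatedTableChowla.Negative
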